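import Mathlib
import Summits.ResolutionOfSingularities.ResolutionOfSingularities.Theorems.RadicialJungCleanModelsLens5ArcPotentialBricks
import HarnessLib

/-!
# Route `RadicialJung`, crux `CleanModels` (stmt-15917): THEOREM P (res-B-lens-5 g7), part 2 — the CORE potential argument along the
# quadratic sequence (PORT of `Cruxes/DescentPerfectToAll/Lens5_ArcPotential.lean`, 66960002e3bd; author res-B-lens-5 g7)

Line `Sketch` rev 22 of crux stmt-ResolutionOfSingularities-15917; lead `res-B-lead-1` g3 re-homes the file (namespace
`…Theorems.RadicialJung.CleanModels.Lens5.ArcPotentialProof`).  OURS; nothing here proves resolution in characteristic `p`.  Contents: the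
hypothesis package (a 16-fold conjunction `H`, namespace `CoreHyp`, with its projections), the three exits (loose clean forms (3), (2), (1),
written out as a disjunction), the potential bookkeeping and `core` — some stage `n` and approximant `c` realise an exit.  (The lead inlined
the author's auxiliary `structure CoreHyp` / `def CoreExit` / `def bonus`, so that the file is definition-free.)
-/

noncomputable section

set_option linter.dupNamespace false -- mandated namespace of this single-conjunct summit
set_option linter.unusedSectionVars false -- ported file: section variables shared across the author's bricks

open IsLocalRing
open Literature.AlgebraicGeometry.Resolution
open Summit.ResolutionOfSingularities.ResolutionOfSingularities.Theorems.RadicialJung.CleanModels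

namespace Summit.ResolutionOfSingularities.ResolutionOfSingularities.Theorems.RadicialJung.CleanModels.Lens5.ArcPotentialProof

variable {K : Type} [Field K]

/-! ## The core: the potential argument along the quadratic sequence -/

section Core

variable {O : ValuationSubring K} {p : ℕ}


/-- **Transport with factor `π`.**  Along the `π`-charts, if `s • D` preserves `R 0` then `π^N s • D` preserves `R N`. [folklore] -/
theorem derivation_transport_pow {O : ValuationSubring K} (R : ℕ → Subring K) [∀ i, IsLocalRing (R i)]
    (h0 : SubringDominates (R 0) O.toSubring) (hstep : ∀ i, IsQuadraticTransformAlong O (R i) (R (i + 1)))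
    (π : K) (hπR : π ∈ R 0) (hπ0 : π ≠ 0) (hvπ : O.valuation π < 1)
    (hπ : ∀ x : K, O.valuation x < 1 → O.valuation x ≤ O.valuation π)
    (D : Derivation ℤ K K) (s : K) (hD : ∀ y ∈ R 0, s * D y ∈ R 0) :
    ∀ N, ∀ y ∈ R N, π ^ N * s * D y ∈ R N := by
  intro N
  induction N with
  | zero => intro y hy; rw [pow_zero, one_mul]; exact hD y hy
  | succ N ih =>
    obtain ⟨hπN, hRN⟩ := succ_eq_locAtCentre_blowupRing R h0 hstep π hπR hπ0 hvπ hπ N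
    let E : Derivation ℤ K K := (π ^ N * s) • D
    have hE : ∀ y, E y = π ^ N * s * D y := fun y => by simp [E, smul_eq_mul]
    have hEN : ∀ y ∈ R N, E y ∈ R N := fun y hy => by rw [hE]; exact ih y hy
    have hB := mul_derivation_mem_blowupRing E hEN hπN hπ0
    have hL := mul_derivation_mem_locAtCentre E π (B := blowupRing (R N) π) (O := O) hB
    intro y hy
    rw [hRN] at hy
    have := hL y hy
    rw [hE] at this
    rw [hRN]
    have e : π ^ (N + 1) * s * D y = π * (π ^ N * s * D y) := by ring
    rw [e]
    exact this

namespace CoreHyp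

variable {R : ℕ → Subring K} [hRloc : ∀ i, IsLocalRing (R i)] {π : K} {D : Derivation ℤ K K} {s h u : K} {e₀ : ℕ}
  (H : (∀ i, IsRegularLocalRing (R i)) ∧ (∀ i, ringKrullDim (R i) = 3) ∧ SubringDominates (R 0) O.toSubring ∧
      (∀ i, IsQuadraticTransformAlong O (R i) (R (i + 1))) ∧ π ∈ R 0 ∧ π ≠ 0 ∧ O.valuation π < 1 ∧
      (∀ x : K, O.valuation x < 1 → O.valuation x ≤ O.valuation π) ∧
      (∀ x : K, x ≠ 0 → ∃ n : ℕ, O.valuation π ^ n ≤ O.valuation x) ∧ (∀ y ∈ R 0, s * D y ∈ R 0) ∧ h ∈ R 0 ∧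
      (∀ c : K, c ^ p ≠ h) ∧ (∀ c : K, ∃ c' : K, O.valuation (h - c' ^ p) < O.valuation (h - c ^ p)) ∧ u ∈ R 0 ∧
      O.valuation u = 1 ∧ s * D h = π ^ e₀ * u)
include H

/-- Component `reg` of the THEOREM P hypothesis package (res-B-lens-5 g7). [folklore] -/
theorem reg : ∀ i, IsRegularLocalRing (R i) := H.1

/-- Component `dim` of the THEOREM P hypothesis package (res-B-lens-5 g7). [folklore] -/
theorem dim : ∀ i, ringKrullDim (R i) = 3 := H.2.1

/-- Component `dom0` of the THEOREM P hypothesis package (res-B-lens-5 g7). [folklore] -/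
theorem dom0 : SubringDominates (R 0) O.toSubring := H.2.2.1

/-- Component `step` of the THEOREM P hypothesis package (res-B-lens-5 g7). [folklore] -/
theorem step : ∀ i, IsQuadraticTransformAlong O (R i) (R (i + 1)) := H.2.2.2.1

/-- Component `πR` of the THEOREM P hypothesis package (res-B-lens-5 g7). [folklore] -/
theorem πR : π ∈ R 0 := H.2.2.2.2.1

/-- Component `π0` of the THEOREM P hypothesis package (res-B-lens-5 g7). [folklore] -/
theorem π0 : π ≠ 0 := H.2.2.2.2.2.1

/-- Component `vπ` of the THEOREM P hypothesis package (res-B-lens-5 g7). [folklore] -/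
theorem vπ : O.valuation π < 1 := H.2.2.2.2.2.2.1

/-- Component `πmax` of the THEOREM P hypothesis package (res-B-lens-5 g7). [folklore] -/
theorem πmax : ∀ x : K, O.valuation x < 1 → O.valuation x ≤ O.valuation π := H.2.2.2.2.2.2.2.1

/-- Component `arch` of the THEOREM P hypothesis package (res-B-lens-5 g7). [folklore] -/
theorem arch : ∀ x : K, x ≠ 0 → ∃ n : ℕ, O.valuation π ^ n ≤ O.valuation x := H.2.2.2.2.2.2.2.2.1

/-- Component `der` of the THEOREM P hypothesis package (res-B-lens-5 g7). [folklore] -/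
theorem der : ∀ y ∈ R 0, s * D y ∈ R 0 := H.2.2.2.2.2.2.2.2.2.1

/-- Component `hR` of the THEOREM P hypothesis package (res-B-lens-5 g7). [folklore] -/
theorem hR : h ∈ R 0 := H.2.2.2.2.2.2.2.2.2.2.1

/-- Component `np` of the THEOREM P hypothesis package (res-B-lens-5 g7). [folklore] -/
theorem np : ∀ c : K, c ^ p ≠ h := H.2.2.2.2.2.2.2.2.2.2.2.1

/-- Component `defect` of the THEOREM P hypothesis package (res-B-lens-5 g7). [folklore] -/
theorem defect : ∀ c : K, ∃ c' : K, O.valuation (h - c' ^ p) < O.valuation (h - c ^ p) := H.2.2.2.2.2.2.2.2.2.2.2.2.1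

/-- Component `uR` of the THEOREM P hypothesis package (res-B-lens-5 g7). [folklore] -/
theorem uR : u ∈ R 0 := H.2.2.2.2.2.2.2.2.2.2.2.2.2.1

/-- Component `vu` of the THEOREM P hypothesis package (res-B-lens-5 g7). [folklore] -/
theorem vu : O.valuation u = 1 := H.2.2.2.2.2.2.2.2.2.2.2.2.2.2.1

/-- Component `Dh` of the THEOREM P hypothesis package (res-B-lens-5 g7). [folklore] -/
theorem Dh : s * D h = π ^ e₀ * u := H.2.2.2.2.2.2.2.2.2.2.2.2.2.2.2


/-- `dom` (THEOREM P core, res-B-lens-5 g7; see the module docstring). [folklore] -/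
theorem dom (i : ℕ) : SubringDominates (R i) O.toSubring := (sequence_dominates (CoreHyp.dom0 H) (CoreHyp.step H) i).1

/-- `mono` (THEOREM P core, res-B-lens-5 g7; see the module docstring). [folklore] -/
theorem mono {i j : ℕ} (hij : i ≤ j) : R i ≤ R j := sequence_monotone (CoreHyp.step H) hij

/-- `le_O` (THEOREM P core, res-B-lens-5 g7; see the module docstring). [folklore] -/
theorem le_O (i : ℕ) : R i ≤ O.toSubring := ((CoreHyp.dom H) i).1

/-- `mem_max` (THEOREM P core, res-B-lens-5 g7; see the module docstring). [folklore] -/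
theorem mem_max (i : ℕ) (a : R i) : a ∈ maximalIdeal (R i) ↔ O.valuation (a : K) < 1 :=
  (subringDominates_valuationSubring_iff ((CoreHyp.dom H) i).1).mp ((CoreHyp.dom H) i) a

/-- `πRi` (THEOREM P core, res-B-lens-5 g7; see the module docstring). [folklore] -/
theorem πRi (i : ℕ) : π ∈ R i := (CoreHyp.mono H) (Nat.zero_le i) (CoreHyp.πR H)

/-- `πmem` (THEOREM P core, res-B-lens-5 g7; see the module docstring). [folklore] -/
theorem πmem (i : ℕ) : (⟨π, (CoreHyp.πRi H) i⟩ : R i) ∈ maximalIdeal (R i) := ((CoreHyp.mem_max H) i _).mpr (CoreHyp.vπ H)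

/-- `πnot2` (THEOREM P core, res-B-lens-5 g7; see the module docstring). [folklore] -/
theorem πnot2 (i : ℕ) : (⟨π, (CoreHyp.πRi H) i⟩ : R i) ∉ maximalIdeal (R i) ^ 2 := by
  intro h2
  have hle := valuation_le_sq_of_mem_sq' ((CoreHyp.dom H) i) (CoreHyp.πmax H) _ h2
  change O.valuation π ≤ O.valuation π ^ 2 at hle
  have hvπpos : 0 < O.valuation π := zero_lt_iff.mpr ((Valuation.ne_zero_iff _).mpr (CoreHyp.π0 H))
  rw [pow_two] at hle
  have : O.valuation π * 1 ≤ O.valuation π * O.valuation π := by rwa [mul_one]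
  exact absurd (le_of_mul_le_mul_left this hvπpos) (not_le.mpr (CoreHyp.vπ H))

/-- `vπpos` (THEOREM P core, res-B-lens-5 g7; see the module docstring). [folklore] -/
theorem vπpos : 0 < O.valuation π := zero_lt_iff.mpr ((Valuation.ne_zero_iff _).mpr (CoreHyp.π0 H))

/-- `pow_strictAnti` (THEOREM P core, res-B-lens-5 g7; see the module docstring). [folklore] -/
theorem pow_strictAnti : StrictAnti (fun n : ℕ => O.valuation π ^ n) := pow_right_strictAnti₀ (CoreHyp.vπpos H) (CoreHyp.vπ H)

/-- `pow_le_pow_iff` (THEOREM P core, res-B-lens-5 g7; see the module docstring). [folklore] -/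
theorem pow_le_pow_iff {a b : ℕ} : O.valuation π ^ a ≤ O.valuation π ^ b ↔ b ≤ a :=
  StrictAnti.le_iff_ge (CoreHyp.pow_strictAnti H)

/-- `pow_lt_pow_iff` (THEOREM P core, res-B-lens-5 g7; see the module docstring). [folklore] -/
theorem pow_lt_pow_iff {a b : ℕ} : O.valuation π ^ a < O.valuation π ^ b ↔ b < a :=
  StrictAnti.lt_iff_gt (CoreHyp.pow_strictAnti H)

/-- `pow_inj` (THEOREM P core, res-B-lens-5 g7; see the module docstring). [folklore] -/
theorem pow_inj {a b : ℕ} (hab : O.valuation π ^ a = O.valuation π ^ b) : a = b :=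
  StrictAnti.injective (CoreHyp.pow_strictAnti H) hab

/-- `uRi` (THEOREM P core, res-B-lens-5 g7; see the module docstring). [folklore] -/
theorem uRi (i : ℕ) : u ∈ R i := (CoreHyp.mono H) (Nat.zero_le i) (CoreHyp.uR H)

/-- `u_unit` (THEOREM P core, res-B-lens-5 g7; see the module docstring). [folklore] -/
theorem u_unit (i : ℕ) : IsUnit (⟨u, (CoreHyp.uRi H) i⟩ : R i) := isUnit_of_valuation_eq_one R (CoreHyp.dom0 H) (CoreHyp.step H) i u ((CoreHyp.uRi H) i) (CoreHyp.vu H)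

/-- Stage transport of the derivation: `π^N s • D` preserves `R N`. [folklore] -/
theorem derN : ∀ N, ∀ y ∈ R N, π ^ N * s * D y ∈ R N :=
  derivation_transport_pow R (CoreHyp.dom0 H) (CoreHyp.step H) π (CoreHyp.πR H) (CoreHyp.π0 H) (CoreHyp.vπ H) (CoreHyp.πmax H) D s (CoreHyp.der H)

/-- `derNπ` (THEOREM P core, res-B-lens-5 g7; see the module docstring). [folklore] -/
theorem derNπ {N : ℕ} (hN : 1 ≤ N) : ∃ ε ∈ R N, π ^ N * s * D π = π * ε := by
  obtain ⟨M, rfl⟩ := Nat.exists_eq_add_of_le hN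
  refine ⟨π ^ M * (s * D π), (R (1 + M)).mul_mem ((R (1 + M)).pow_mem ((CoreHyp.πRi H) _) M) ((CoreHyp.mono H) (Nat.zero_le _) ((CoreHyp.der H) π (CoreHyp.πR H))), ?_⟩
  ring

/-- `derNh` (THEOREM P core, res-B-lens-5 g7; see the module docstring). [folklore] -/
theorem derNh (N : ℕ) : π ^ N * s * D h = π ^ (e₀ + N) * u := by
  rw [mul_assoc, (CoreHyp.Dh H)]; ring

omit hRloc H in
/-- `derivation_pow_p` (THEOREM P core, res-B-lens-5 g7; see the module docstring). [folklore] -/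
theorem derivation_pow_p [CharP K p] (D : Derivation ℤ K K) (c : K) : D (c ^ p) = 0 := by
  rw [Derivation.leibniz_pow, nsmul_eq_mul, CharP.cast_eq_zero K p, zero_mul]

variable [hp : Fact p.Prime] [CharP K p]

/-- `f_ne` (THEOREM P core, res-B-lens-5 g7; see the module docstring). [folklore] -/
theorem f_ne (c : K) : h - c ^ p ≠ 0 := sub_ne_zero.mpr (Ne.symm ((CoreHyp.np H) c))

/-- `hO` (THEOREM P core, res-B-lens-5 g7; see the module docstring). [folklore] -/
theorem hO : h ∈ O := (CoreHyp.le_O H) 0 (CoreHyp.hR H)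

/-- (P1) at stage `N ≥ 1`: `(h − c^p)/π^a ∈ R N ⇒ a ≤ e₀ + N`. [folklore] -/
theorem P1 {N : ℕ} (hN : 1 ≤ N) {c : K} {a : ℕ} (hF : (h - c ^ p) / π ^ a ∈ R N) : a ≤ e₀ + N := by
  let E : Derivation ℤ K K := (π ^ N * s) • D
  have hE : ∀ y, E y = π ^ N * s * D y := fun y => by simp [E, smul_eq_mul]
  have hEN : ∀ y ∈ R N, E y ∈ R N := fun y hy => by rw [hE]; exact (CoreHyp.derN H) N y hy
  have hEπ : ∃ ε ∈ R N, E π = π * ε := by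
    obtain ⟨ε, hε, h1⟩ := (CoreHyp.derNπ H) hN
    exact ⟨ε, hε, by rw [hE, h1]⟩
  refine jacobian_bound_of_isUnit E hEN ((CoreHyp.πRi H) N) (CoreHyp.π0 H) ((CoreHyp.πmem H) N) hEπ hF ((CoreHyp.uRi H) N) ((CoreHyp.u_unit H) N) (a := a) (e := e₀ + N) ?_
  have e1 : π ^ a * ((h - c ^ p) / π ^ a) = h - c ^ p := mul_div_cancel₀ _ (pow_ne_zero a (CoreHyp.π0 H))
  rw [e1, map_sub, derivation_pow_p, sub_zero, hE, (CoreHyp.derNh H)]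

/-- `v(h − c^p) = v(π)^m` and `(h − c^p)/π^a ∈ R N` give `a ≤ m` and `v((h − c^p)/π^a) = v(π)^(m−a)`. -/
theorem exists_delta {N : ℕ} {c : K} {a m : ℕ} (hF : (h - c ^ p) / π ^ a ∈ R N)
    (hm : O.valuation (h - c ^ p) = O.valuation π ^ m) :
    ∃ δ : ℕ, m = a + δ ∧ O.valuation ((h - c ^ p) / π ^ a) = O.valuation π ^ δ := by
  have hvπa : O.valuation π ^ a ≠ 0 := pow_ne_zero a (CoreHyp.vπpos H).ne'
  have hvF : O.valuation ((h - c ^ p) / π ^ a) = O.valuation π ^ m / O.valuation π ^ a := by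
    rw [map_div₀, map_pow, hm]
  have hle1 : O.valuation ((h - c ^ p) / π ^ a) ≤ 1 := (O.valuation_le_one_iff _).mpr ((CoreHyp.le_O H) N hF)
  have ham : a ≤ m := by
    rw [hvF, div_le_one₀ (zero_lt_iff.mpr hvπa)] at hle1
    exact (CoreHyp.pow_le_pow_iff H).mp hle1
  obtain ⟨δ, rfl⟩ := Nat.exists_eq_add_of_le ham
  refine ⟨δ, rfl, ?_⟩
  rw [hvF, pow_add, mul_div_cancel_left₀ _ hvπa]

/-- `exists_ord` (THEOREM P core, res-B-lens-5 g7; see the module docstring). [folklore] -/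
theorem exists_ord (c : K) (hc : c ∈ O) : ∃ m : ℕ, O.valuation (h - c ^ p) = O.valuation π ^ m :=
  exists_valuation_eq_pow_of_discrete O π (CoreHyp.πmax H) (CoreHyp.arch H) (h - c ^ p) ((CoreHyp.f_ne H) c) (O.sub_mem (CoreHyp.hO H) (O.pow_mem hc p))

/-- `p_dvd_ord` (THEOREM P core, res-B-lens-5 g7; see the module docstring). [folklore] -/
theorem p_dvd_ord {c : K} (hc : c ∈ O) {m : ℕ} (hm : O.valuation (h - c ^ p) = O.valuation π ^ m) : p ∣ m := by
  obtain ⟨j, hj⟩ := valuation_sub_pow_eq_pow_mul O π (CoreHyp.π0 H) (CoreHyp.vπ H) (CoreHyp.πmax H) (CoreHyp.arch H) h (CoreHyp.hO H) (CoreHyp.np H) (CoreHyp.defect H) c hc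
  rw [hm] at hj
  exact ⟨j, (CoreHyp.pow_inj H) hj⟩

omit hRloc H hp in
/-- `bonus_le` (THEOREM P core, res-B-lens-5 g7; see the module docstring). [folklore] -/
theorem bonus_le (δ : ℕ) : (if δ = 0 then 1 else if δ = 1 then 2 else 0 : ℕ) ≤ 2 := by
  split_ifs <;> omega

/-- **The potential induction** (P3)–(P5): from any state `(N, c, a)` with `(h − c^p)/π^a ∈ R N` the algorithm reaches an exit. -/
theorem core_aux : ∀ (μ : ℕ) (N a m : ℕ) (c : K), c ∈ R N → (h - c ^ p) / π ^ a ∈ R N →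
    O.valuation (h - c ^ p) = O.valuation π ^ m → 3 * (e₀ + N - a) + (if m - a = 0 then 1 else if m - a = 1 then 2 else 0 : ℕ) ≤ μ →
    ∃ (n : ℕ) (c' : K), (∃ (m' : ℕ) (G : R n), G ∈ maximalIdeal (R n) ∧ G ∉ maximalIdeal (R n) ^ 2 ∧ (G : K) = (h - c' ^ p) / π ^ (p * m')) ∨
      (∃ (m' : ℕ) (U : R n), IsUnit U ∧ (U : K) = (h - c' ^ p) / π ^ (p * m') ∧
        ∀ c'' : R n, U - c'' ^ p ∉ maximalIdeal (R n)) ∨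
      (∃ (m' r : ℕ) (hπn : π ∈ R n) (F t₃ : R n), 0 < r ∧ r < p ∧
        maximalIdeal (R n) = Ideal.span {⟨π, hπn⟩, F, t₃} ∧ (h - c' ^ p) / π ^ (p * m') = π ^ r * (F : K)) := by
  intro μ
  induction μ using Nat.strong_induction_on with
  | _ μ ih =>
  intro N a m c hcR hF hm hμ
  classical
  obtain ⟨δ, rfl, hvF⟩ := (CoreHyp.exists_delta H) hF hm
  rw [Nat.add_sub_cancel_left] at hμ
  set f : K := h - c ^ p with hfdef
  set F : K := f / π ^ a with hFdef
  have hfF : f = π ^ a * F := by rw [hFdef, mul_div_cancel₀ _ (pow_ne_zero a (CoreHyp.π0 H))]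
  have hcO : c ∈ O := (CoreHyp.le_O H) N hcR
  let Fr : R N := ⟨F, hF⟩
  rcases Nat.lt_or_ge δ 1 with hδ | hδ
  · -- δ = 0 : unit case (P3)
    have hδ0 : δ = 0 := by omega
    subst hδ0
    rw [pow_zero] at hvF
    have hunit : IsUnit Fr := isUnit_of_valuation_eq_one R (CoreHyp.dom0 H) (CoreHyp.step H) N F hF hvF
    obtain ⟨j, hj⟩ := (CoreHyp.p_dvd_ord H) hcO hm
    rw [Nat.add_zero] at hj
    by_cases hβ : ∃ β : R N, Fr - β ^ p ∈ maximalIdeal (R N)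
    · -- update `c ↦ c + π^j β`
      obtain ⟨β, hβ⟩ := hβ
      set c' : K := c + π ^ j * (β : K) with hc'def
      have hc'R : c' ∈ R N := (R N).add_mem hcR ((R N).mul_mem ((R N).pow_mem ((CoreHyp.πRi H) N) j) β.2)
      have hf' : h - c' ^ p = π ^ a * (F - (β : K) ^ p) := by
        rw [hc'def, add_pow_char, mul_pow, ← pow_mul, mul_comm j p, ← hj, mul_sub, ← hfF, hfdef]; ring
      have hF' : (h - c' ^ p) / π ^ a ∈ R N := by
        rw [hf', mul_div_cancel_left₀ _ (pow_ne_zero a (CoreHyp.π0 H))]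
        exact (R N).sub_mem hF ((R N).pow_mem β.2 p)
      obtain ⟨m', hm'⟩ := (CoreHyp.exists_ord H) c' ((CoreHyp.le_O H) N hc'R)
      obtain ⟨δ', hδ'eq, hvF'⟩ := (CoreHyp.exists_delta H) hF' hm'
      -- `δ' ≥ 2`
      have hvlt : O.valuation ((h - c' ^ p) / π ^ a) < 1 := by
        rw [hf', mul_div_cancel_left₀ _ (pow_ne_zero a (CoreHyp.π0 H))]
        exact ((CoreHyp.mem_max H) N (Fr - β ^ p)).mp hβ
      have hδ'pos : 0 < δ' := by
        rw [hvF'] at hvlt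
        by_contra h0
        have : δ' = 0 := by omega
        rw [this, pow_zero] at hvlt
        exact lt_irrefl _ hvlt
      have hpd : p ∣ m' := (CoreHyp.p_dvd_ord H) ((CoreHyp.le_O H) N hc'R) hm'
      have hδ'2 : 2 ≤ δ' := by
        have hp2 : 2 ≤ p := hp.out.two_le
        obtain ⟨j', hj'⟩ := hpd
        have : p * j < p * j' := by rw [← hj, ← hj', hδ'eq]; omega
        have hjj : j + 1 ≤ j' := Nat.lt_of_mul_lt_mul_left this
        have : a + δ' = p * j' := by rw [← hδ'eq, hj']
        nlinarith
      refine ih _ ?_ N a m' c' hc'R hF' hm' le_rfl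
      rw [hδ'eq, Nat.add_sub_cancel_left]
      have hb : (if δ' = 0 then 1 else if δ' = 1 then 2 else 0 : ℕ) = 0 := by rw [if_neg (by omega), if_neg (by omega)]
      have hb0 : (if 0 = 0 then 1 else if 0 = 1 then 2 else 0 : ℕ) = 1 := by rw [if_pos rfl]
      rw [hb0] at hμ; rw [hb]; omega
    · -- EXIT, loose clean form (2)
      push Not at hβ
      refine ⟨N, c, Or.inr (Or.inl ⟨j, Fr, hunit, ?_, hβ⟩)⟩
      change F = (h - c ^ p) / π ^ (p * j)
      rw [← hj]
  rcases Nat.lt_or_ge δ 2 with hδ2 | hδ2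
  · -- δ = 1 : blow up (shape L2)
    have hδ1 : δ = 1 := by omega
    subst hδ1
    rw [pow_one] at hvF
    have hvF1 : O.valuation F < 1 := by rw [hvF]; exact (CoreHyp.vπ H)
    have hF' : F / π ∈ R (N + 1) := div_mem_succ_of_lt R (CoreHyp.dom0 H) (CoreHyp.step H) π (CoreHyp.πR H) (CoreHyp.π0 H) (CoreHyp.vπ H) (CoreHyp.πmax H) N F hF hvF1
    have hF'' : (h - c ^ p) / π ^ (a + 1) ∈ R (N + 1) := by
      have e : (h - c ^ p) / π ^ (a + 1) = F / π := by rw [hFdef, hfdef, pow_succ, div_div]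
      rw [e]; exact hF'
    refine ih _ ?_ (N + 1) (a + 1) (a + 1) c ((CoreHyp.mono H) (Nat.le_succ N) hcR) hF'' hm le_rfl
    have e1 : e₀ + (N + 1) - (a + 1) = e₀ + N - a := by omega
    rw [e1, Nat.sub_self]
    have hb0 : (if 0 = 0 then 1 else if 0 = 1 then 2 else 0 : ℕ) = 1 := by rw [if_pos rfl]
    have hb1 : (if 1 = 0 then 1 else if 1 = 1 then 2 else 0 : ℕ) = 2 := by rw [if_neg one_ne_zero, if_pos rfl]
    rw [hb1] at hμ; rw [hb0]; omega
  -- δ ≥ 2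
  have hvF1 : O.valuation F < 1 := by
    rw [hvF]; exact pow_lt_one₀ zero_le (CoreHyp.vπ H) (by omega)
  have hFm : Fr ∈ maximalIdeal (R N) := ((CoreHyp.mem_max H) N Fr).mpr hvF1
  have hbδ : (if δ = 0 then 1 else if δ = 1 then 2 else 0 : ℕ) = 0 := by rw [if_neg (by omega), if_neg (by omega)]
  rw [hbδ, Nat.add_zero] at hμ
  by_cases hF2 : Fr ∈ maximalIdeal (R N) ^ 2
  · -- blow up (shape L1): `a` rises by `2`
    have hF' : F / π ^ 2 ∈ R (N + 1) := div_pow_mem_succ_of_mem_pow R (CoreHyp.dom0 H) (CoreHyp.step H) π (CoreHyp.πR H) (CoreHyp.π0 H) (CoreHyp.vπ H) (CoreHyp.πmax H) N 2 Fr hF2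
    have hF'' : (h - c ^ p) / π ^ (a + 2) ∈ R (N + 1) := by
      have e : (h - c ^ p) / π ^ (a + 2) = F / π ^ 2 := by rw [hFdef, hfdef, pow_add, div_div]
      rw [e]; exact hF'
    have hP1 := (CoreHyp.P1 H) (Nat.le_add_left 1 N) hF''
    refine ih _ ?_ (N + 1) (a + 2) (a + δ) c ((CoreHyp.mono H) (Nat.le_succ N) hcR) hF'' hm le_rfl
    have hb := bonus_le (a + δ - (a + 2))
    omega
  · -- EXIT by the valuative detector (P2)
    have hvF2 : O.valuation (Fr : K) ≤ O.valuation π ^ 2 := by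
      change O.valuation F ≤ _; rw [hvF]; exact (CoreHyp.pow_le_pow_iff H).mpr hδ2
    have hind : ∀ a' b' : R N, a' * ⟨π, (CoreHyp.πRi H) N⟩ + b' * Fr ∈ maximalIdeal (R N) ^ 2 → b' ∈ maximalIdeal (R N) :=
      fun a' b' hab => (indep_of_valuation ((CoreHyp.dom H) N) ((CoreHyp.πRi H) N) (CoreHyp.π0 H) ((CoreHyp.πmem H) N) (CoreHyp.πmax H) Fr hFm hF2 hvF2 a' b' hab).2
    haveI : IsRegularLocalRing (R N) := (CoreHyp.reg H) N
    obtain ⟨x₀, x₁, x₂, hx⟩ := exists_span_triple ((CoreHyp.reg H) N) ((CoreHyp.dim H) N)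
    obtain ⟨t₃, ht₃⟩ := exists_span_triple_of_indep x₀ x₁ x₂ ⟨π, (CoreHyp.πRi H) N⟩ Fr hx ((CoreHyp.πmem H) N) ((CoreHyp.πnot2 H) N) hFm hind
    by_cases hpa : p ∣ a
    · -- loose clean form (3)
      obtain ⟨m', hm'⟩ := hpa
      refine ⟨N, c, Or.inl ⟨m', Fr, hFm, hF2, ?_⟩⟩
      change F = (h - c ^ p) / π ^ (p * m')
      rw [← hm']
    · -- loose clean form (1) with exponents `(r, 1)`
      refine ⟨N, c, Or.inr (Or.inr ⟨a / p, a % p, (CoreHyp.πRi H) N, Fr, t₃, Nat.pos_of_ne_zero fun h0 => hpa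
        (Nat.dvd_of_mod_eq_zero h0), Nat.mod_lt a hp.out.pos, ht₃, ?_⟩)⟩
      change (h - c ^ p) / π ^ (p * (a / p)) = π ^ (a % p) * F
      have hdm : a = p * (a / p) + a % p := (Nat.div_add_mod a p).symm
      rw [← hfdef, hfF]
      nth_rw 1 [hdm]
      rw [pow_add, mul_assoc, mul_div_cancel_left₀ _ (pow_ne_zero _ (CoreHyp.π0 H))]

/-- **THEOREM P, core form.** [folklore] -/
theorem core : ∃ (n : ℕ) (c : K),
    (∃ (m' : ℕ) (G : R n), G ∈ maximalIdeal (R n) ∧ G ∉ maximalIdeal (R n) ^ 2 ∧ (G : K) = (h - c ^ p) / π ^ (p * m')) ∨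
      (∃ (m' : ℕ) (U : R n), IsUnit U ∧ (U : K) = (h - c ^ p) / π ^ (p * m') ∧
        ∀ c'' : R n, U - c'' ^ p ∉ maximalIdeal (R n)) ∨
      (∃ (m' r : ℕ) (hπn : π ∈ R n) (F t₃ : R n), 0 < r ∧ r < p ∧
        maximalIdeal (R n) = Ideal.span {⟨π, hπn⟩, F, t₃} ∧ (h - c ^ p) / π ^ (p * m') = π ^ r * (F : K)) := by
  obtain ⟨m, hm⟩ := (CoreHyp.exists_ord H) 0 O.zero_mem
  refine (CoreHyp.core_aux H) _ 0 0 m 0 (R 0).zero_mem ?_ hm le_rfl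
  rw [pow_zero, div_one, zero_pow hp.out.ne_zero, sub_zero]
  exact (CoreHyp.hR H)

end CoreHyp

end Core


end Summit.ResolutionOfSingularities.ResolutionOfSingularities.Theorems.RadicialJung.CleanModels.Lens5.ArcPotentialProof

end
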